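import Summits.HodgeConjecture.HodgeConjecture.Theorems.HeckePrymWeilWeilDescendingUpward
import Summits.HodgeConjecture.HodgeConjecture.Theorems.HeckePrymWeilProductDescentTransfer
import Literature.AlgebraicGeometry.HodgeTheory.AlgebraicClassesCupAbelianVariety
import Literature.AlgebraicGeometry.HodgeTheory.HodgeTypePullback
import Literature.AlgebraicGeometry.HodgeTheory.CupPreservesHodgeTypeOfDeRham
import Literature.AlgebraicGeometry.HodgeTheory.HodgeFiltrationModelsReductionProofs
import Literature.AlgebraicGeometry.Motives.ComplexPointsOrientation

/-!
# `ProductDescent` (stmt-HodgeConjecture-14498) · II · assembly, conditional on four named facts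

Route `HeckePrymWeil`, support item `ProductDescent` — the downward half of Schoen's product step,
discriminant-free (C. Schoen, *Addendum to: Hodge classes on self-products of a variety with an
automorphism*, Compositio Math. 114 (1998), §10 Proposition and proof, pp. 332–333; E. Markman,
arXiv:2509.23403 §11.5 Step 2; K. Koike, doi:10.4153/cmb-2004-055-x): for a prime `p ≡ 3 (4)`,
`p ≥ 7` and `n ≥ 1`, IF every abelian `2n`-fold `(A, φ)` with `φ∘φ = -p` has a partner Weil surface
`(B, ψ)` (with a non-zero rational `(1,1)` class `b` in its Weil plane) such that every rational
`(n+1,n+1)` Weil class of `(A × B, φ × ψ)` is algebraic, THEN every rational `(n,n)` Weil class of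
every such `(A, φ)` is algebraic.

`productDescent_of` PROVES the route decl `Theses.HeckePrymWeil.ProductDescent` on the tree's real
carriers GRANTED four NAMED FACTS of `Literature/` (D-0014; the theorem is CONDITIONAL on exactly
these, nothing else is assumed):

1. `nonempty_hodgeModel` (Serre GAGA + de Rham + Hodge decomposition: smooth projective varieties
   have Hodge models) — for the product `A × B`, whose Hodge type `(n+1,n+1)` of
   `pr_A^* w ∪ pr_B^* b` must be CERTIFIED to feed the hypothesis;
2. `exists_deRhamIsoFamily` (de Rham's theorem, multiplicative form) — the cup product respects
   Hodge types (`cupPreservesHodgeType_of_nonempty_hodgeModel`);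
3. `lefschetzOneOne_rational` (Lefschetz's theorem on `(1,1)`-classes) and
4. `hodgeIndex_surface` (Hodge index theorem for surfaces, sign-free homological form) — together:
   the rational `(1,1)` class `b = b₊ + b₋` of the ABSTRACT partner surface `B` has an ALGEBRAIC
   divisor class `t` with `b± ∪ t ≠ 0` (`exists_algebraic_partner_of_hodgeIndex`, file I). Schoen's
   printed proof uses exactly this ("`W_{A'}` is generated by cohomology classes of divisors" and the
   surjectivity of `W_{A×A'} ⊗ W_{A'} → W_A ⊗ H⁴(A') → W_A`); the item's hypothesis records `b` only as
   a rational `(1,1)` class, so on the carriers the two facts are load-bearing.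

Everything else is a THEOREM of the tree and is used as such: the upward half (rational Weil
projector, `weilEigencomponents_mem_algebraicClasses_of_rung`), the real Gysin maps `complexGysin μ`
with Poincaré duality (`OrientationFamily.hasPoincareDuality`), orientations
(`Motives.ComplexPoints.isOrientableOver`), the projection formula, Borel–Moore base change
(`gysinMap_restrictCompl_eq_zero_of_field`), Künneth (`kunnethSpan_complexBetti`), moving divisors
by translations on abelian varieties (`AbelianVariety.cupProduct_mem_algebraicClasses_one`),
independence of the Hodge type from the model (`hodgePQ_independent_of_hodgeModel_holds`).

Proof (Schoen §10 / Markman §11.5 Step 2, component-free): `w = w₊ + w₋`, `b = b₊ + b₋` along the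
eigenvalues `(1 ± i√p)^{2n}`, `(1 ± i√p)²` of `(𝟙+φ)^*`, `(𝟙+ψ)^*`; `P = pr_A^* w ∪ pr_B^* b` is rational
of type `(n+1,n+1)` (facts 1–2), so the upward half and the hypothesis make `pr_A^* w± ∪ pr_B^* b±`
algebraic on `A × B`; with the partner divisor class `t` (facts 3–4),
`(pr_A^* w± ∪ pr_B^* b±) ∪ pr_B^* t` is algebraic (moving by translations), its Gysin image under
`pr_A` is algebraic and equals `ε± • w±` with `ε± • 1 = pr_{A*} pr_B^*(b± ∪ t) ≠ 0` (fibre integral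
of a non-zero top class); hence `w±`, and `w`, are algebraic.
-/

noncomputable section

-- every declaration of this problem lives in `Summit.HodgeConjecture.HodgeConjecture.…` (summit = sub-problem)
set_option linter.dupNamespace false

open scoped Manifold
open CategoryTheory MonoidalCategory CartesianMonoidalCategory
open Literature.AlgebraicGeometry Literature.AlgebraicGeometry.HodgeTheory
open Literature.AlgebraicTopology.SingularHomology
open Summit.HodgeConjecture.HodgeConjecture.Theorems.WeilTwelvefoldsSqrtMinus7.Negative
  (one_add_I_sqrt_pow_ne)

namespace Summit.HodgeConjecture.HodgeConjecture.Theorems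

/-- `conj (1 + i√p) = 1 - i√p` (`√p` is real). -/
theorem starRingEnd_one_add_I_sqrt (p : ℕ) :
    starRingEnd ℂ (1 + Complex.I * (Real.sqrt (p : ℝ) : ℂ)) = 1 - Complex.I * (Real.sqrt (p : ℝ) : ℂ) := by
  rw [map_add, map_one, map_mul, Complex.conj_I, Complex.conj_ofReal, neg_mul, sub_eq_add_neg]

/-- **`ProductDescent` (route `HeckePrymWeil`, item stmt-HodgeConjecture-14498), conditional on the
four named facts `nonempty_hodgeModel`, `exists_deRhamIsoFamily`, `lefschetzOneOne_rational`,
`hodgeIndex_surface`.** Schoen's product step, downward half, discriminant-free (Schoen 1998 §10,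
Proposition and proof; Markman arXiv:2509.23403 §11.5 Step 2; Koike 2004): see the module docstring
for the statement, the proof, and why each fact is needed. -/
theorem productDescent_of
    (hM : ∀ (m : ℕ) (X : Motives.SchemeOver ℂ), nonempty_hodgeModel m X)
    (hdR : ∀ (E : Type) [NormedAddCommGroup E] [NormedSpace ℂ E] [FiniteDimensional ℂ E],
      Literature.NumberTheory.Transcendental.exists_deRhamIsoFamily 𝓘(ℝ, E))
    (hL : lefschetzOneOne_rational) (hHI : ∀ X : Motives.SchemeOver ℂ, hodgeIndex_surface X) :
    Theses.HeckePrymWeil.ProductDescent := by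
  intro p _hp hp4 hp7 n hn hyp A φ hAdim _hφ c hc hcH hcW
  -- the partner surface and the algebraicity of the rational `(n+1,n+1)` Weil classes of `A × B`
  obtain ⟨B, ψ, hBdim, -, ⟨b, hb0, hbr, hbH, hbW⟩, halgAB⟩ := hyp A φ hAdim _hφ
  -- smoothness witnesses and the orientation family
  have hp4' : 4 ≤ p := by omega
  have hA : Motives.IsSmoothProjective (2 * n) A.X := isSmoothProjective_of_dim_eq hAdim
  have hB : Motives.IsSmoothProjective (2 * 1) B.X := isSmoothProjective_of_dim_eq hBdim
  have hAB : Motives.IsSmoothProjective (2 * (n + 1)) (A.prod B).X := isSmoothProjective_prod_two_mul hA hB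
  have hABt : Motives.IsSmoothProjective (2 * n + 2 * 1) (A.prod B).X :=
    Motives.IsSmoothProjective.tensor_holds hA hB
  let μ : OrientationFamily := fun _ _ h ↦ Classical.choice (Motives.ComplexPoints.isOrientableOver ℂ h)
  -- shorthands for the two eigenvalues
  set sp : ℂ := 1 + Complex.I * (Real.sqrt (p : ℝ) : ℂ) with hsp
  set sm : ℂ := 1 - Complex.I * (Real.sqrt (p : ℝ) : ℂ) with hsm
  have hconj : starRingEnd ℂ sp = sm := starRingEnd_one_add_I_sqrt p
  -- `w = w₊ + w₋`, `b = b₊ + b₋`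
  obtain ⟨cp, hcp, cm, hcm, rfl⟩ := Submodule.mem_sup.1 hcW
  obtain ⟨bp, hbp, bm, hbm, rfl⟩ := Submodule.mem_sup.1 hbW
  rw [Module.End.mem_eigenspace_iff] at hcp hcm hbp hbm
  -- the compatible endomorphism `Φ = φ × ψ`
  set Φ : A.prod B ⟶ A.prod B := Motives.AbelianVariety.prodLift (Motives.AbelianVariety.fst A B ≫ φ)
    (Motives.AbelianVariety.snd A B ≫ ψ) with hΦ
  have h₁ : Φ ≫ Motives.AbelianVariety.fst A B = Motives.AbelianVariety.fst A B ≫ φ :=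
    Motives.AbelianVariety.prodLift_fst _ _
  have h₂ : Φ ≫ Motives.AbelianVariety.snd A B = Motives.AbelianVariety.snd A B ≫ ψ :=
    Motives.AbelianVariety.prodLift_snd _ _
  -- Hodge type `(n+1, n+1)` of `P = pr_A^* w ∪ pr_B^* b` (facts 1 and 2)
  have hI := hodgePQ_independent_of_hodgeModel_holds
  have hfst : PreservesHodgeType (2 * n + 2 * 1) (2 * n) (Motives.AbelianVariety.fst A B).hom.hom.hom :=
    preservesHodgeType_of_nonempty_hodgeModel hI (hM _ _) hABt hA _
  have hsnd : PreservesHodgeType (2 * n + 2 * 1) (2 * 1) (Motives.AbelianVariety.snd A B).hom.hom.hom :=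
    preservesHodgeType_of_nonempty_hodgeModel hI (hM _ _) hABt hB _
  have hcupH : CupPreservesHodgeType (2 * n + 2 * 1) (A.prod B).X :=
    cupPreservesHodgeType_of_nonempty_hodgeModel hI (hM _ _) hdR hABt
  have h : 2 * n + 2 * 1 = 2 * (n + 1) := by ring
  have hH : IsOfHodgeType (2 * (n + 1)) (A.prod B).X (2 * (n + 1)) (n + 1) (n + 1)
      (cupProduct h (complexBetti.map (Motives.AbelianVariety.fst A B).hom.hom.hom (2 * n) (cp + cm))
        (complexBetti.map (Motives.AbelianVariety.snd A B).hom.hom.hom (2 * 1) (bp + bm))) :=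
    isOfHodgeType_cupProduct_map_fst_map_snd h hfst hsnd hcupH hcH hbH
  -- upward half: `pr_A^* w± ∪ pr_B^* b±` are algebraic on `A × B`
  obtain ⟨hP, hMm⟩ := weilEigencomponents_mem_algebraicClasses_of_rung h₁ h₂ hp4' hn h hAB halgAB
    hcp hcm hbp hbm hc hbr hH
  -- the partner divisor class `t` on `B` (facts 3 and 4)
  have hx₂ : sp ^ (2 * 1) ≠ sm ^ (2 * 1) := one_add_I_sqrt_pow_ne p hp4' (2 * 1) (by omega)
  have hα : sp ^ (2 * 1) ≠ starRingEnd ℂ (sp ^ (2 * 1)) := by rwa [map_pow, hconj]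
  have hbm' : complexBetti.map (𝟙 B + ψ).hom.hom.hom 2 bm = starRingEnd ℂ (sp ^ (2 * 1)) • bm := by
    rw [map_pow, hconj]; exact hbm
  have hB2 : Motives.IsSmoothProjective 2 B.X := hB
  have hb0' : bp + bm ≠ 0 := hb0
  obtain ⟨t, htalg, hpt, hmt⟩ := exists_algebraic_partner_of_hodgeIndex (hHI B.X) hL hB2
    (𝟙 B + ψ).hom.hom.hom hα hbp hbm' hbr hbH hb0'
  -- `pr_B^* t` is algebraic on `A × B`, hence so are `(pr_A^* w± ∪ pr_B^* b±) ∪ pr_B^* t`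
  have ht' : complexBetti.map (Motives.AbelianVariety.snd A B).hom.hom.hom (2 * 1) t ∈
      algebraicClasses (A.prod B).X 1 :=
    map_snd_mem_supportedClasses hA hB htalg
  have halgp := AbelianVariety.cupProduct_mem_algebraicClasses_one (A.prod B) hP ht'
  have halgm := AbelianVariety.cupProduct_mem_algebraicClasses_one (A.prod B) hMm ht'
  -- the fibre integrals `pr_{A*} pr_B^*(b± ∪ t) ≠ 0`
  have hjj' : 2 * 1 + 2 * 1 = 2 * (2 * 1) := rfl
  have hpt' : cupProduct hjj' bp t ≠ 0 := hpt
  have hmt' : cupProduct hjj' bm t ≠ 0 := hmt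
  have hnep := complexGysin_fst_map_snd_ne_zero μ hA hB hpt'
  have hnem := complexGysin_fst_map_snd_ne_zero μ hA hB hmt'
  -- Schoen's transfer, component by component
  refine Submodule.add_mem _ ?_ ?_
  · exact mem_algebraicClasses_of_complexGysin_fst_cupProduct μ hA hB (l := n) (j := 2 * 1)
      (j' := 2 * 1) (s := 2 * (n + 1)) h hjj' hnep halgp
  · exact mem_algebraicClasses_of_complexGysin_fst_cupProduct μ hA hB (l := n) (j := 2 * 1)
      (j' := 2 * 1) (s := 2 * (n + 1)) h hjj' hnem halgm

end Summit.HodgeConjecture.HodgeConjecture.Theorems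

end
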